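import Summits.HubbardSuperconductivity.HubbardSuperconductivity.Theorems.LogColdTorusAverageToEveryClosures
import Summits.HubbardSuperconductivity.HubbardSuperconductivity.Theorems.LogColdTorusAverageToEveryStubSchurScalarOnGround
import Summits.HubbardSuperconductivity.HubbardSuperconductivity.Theorems.LogColdTorusAverageToEveryStubBlockAverageWitness
import Summits.HubbardSuperconductivity.HubbardSuperconductivity.Theorems.BalabanIRBirEveryGroundStateSchur
import HarnessLib

/-!
# Route `LogColdTorus`, crux `AverageToEvery` (item `stmt-HubbardSuperconductivity-10519`, shared with route
`AbelianDuality`): the crux closed modulo the Kato–Schur genericity residual (line `birth`)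

Helpers (`--supports`) for the crux
`Summit.HubbardSuperconductivity.HubbardSuperconductivity.Theses.LogColdTorus.AverageToEvery`, composing the
landed stubs of line `birth` (`stub_schurScalarOnGround`, Schur on the joint commutant;
`stub_blockAverageWitness`, the block ↔ Fock dictionary) with the transfer closer
`averageToEvery_of_everyGroundState_transfer`:

* `averageToEvery_of_scalarOnGround` — **`AverageToEvery` holds as soon as its window hypothesis yields
  ONE coupling `U` of the window at which, eventually in even `L`, `Δ_d† Δ_d` has SCALAR matrix
  elements on the sector ground eigenspace `E₀(U, L) = szSector N_L 0 ⊓ ker (H - e₀)`.** (The block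
  average produces one good normalised ground state by the dictionary; a scalar compression makes its
  expectation everybody's.)
* `averageToEvery_of_irreducibleGround` — **… as soon as the window hypothesis yields one coupling at
  which, eventually in even `L`, `E₀(U, L)` is IRREDUCIBLE under the joint commutant
  `{X | [X,H] = [X,N̂] = [X,S^z] = [X,Δ_d†Δ_d] = 0}`** (Schur, `stub_schurScalarOnGround`).
* `averageToEvery_of_simpleGround` — the special case of NON-DEGENERATE sector ground states at one
  coupling of the window (`dim E₀(U, L) = 1` eventually in even `L`; a line is scalar).
* `averageToEvery_of_irreducibleGroundLaw` — the hypothesis-free form: if for every `δ` and every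
  window `(U₁, U₂) ⊂ (0, ∞)` some coupling of the window has eventually-irreducible sector ground
  eigenspaces, then `AverageToEvery`.
* `averageToEvery_of_countableAccidentalCouplings` — **THE CRUX CLOSED MODULO THE BET of line
  `birth`**: the registered stub `stub_countableAccidentalCouplings` (under the window hypothesis,
  from some side on and off COUNTABLY many couplings per side, `E₀(U, L)` is irreducible under the
  joint commutant), taken as a hypothesis, implies `AverageToEvery` — countably many countable sets
  miss a point of the window (`exists_mem_Ioo_forall_not_mem`, where `U₁ < U₂` is consumed). This is
  exactly the composition `AverageToEvery_of` of the skeleton `Cruxes/AverageToEvery/Lines/birth.lean`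
  with its only open stub as the hypothesis; the stub itself (Kato–Rellich genericity of doped Hubbard
  tori: accidental inter-block ground degeneracy at countably many couplings only) is NOT proved here
  and is the whole open content of the crux (sibling census `Cruxes/BirEveryGroundState/STRATEGY-CENSUS.md`:
  kind (A), exact spectral rigidity; model-free form refuted by `not_abstractDarkPartnerExclusion`).

T. Kato, *Perturbation Theory for Linear Operators* (1966) II §6.1; J.-P. Serre, *Linear Representations
of Finite Groups* §2.2; H. Tasaki (2020) §2.1, §9.3; T. Koma, H. Tasaki, J. Stat. Phys. 76 (1994) 745.
Everything proved here is folklore; no definition is introduced.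
-/

noncomputable section

-- `dupNamespace`: the summit and the problem are both named `HubbardSuperconductivity` (layout D-0022)
set_option linter.dupNamespace false

namespace Summit.HubbardSuperconductivity.HubbardSuperconductivity.Theorems

open Matrix Finset Filter
open Literature.Probability.LatticeModels Literature.MathematicalPhysics.QuantumLattice
open scoped ComplexOrder Matrix Classical

/-- **`AverageToEvery` from a scalar compression at one coupling of the window.** If for all data
`(δ, U₁, U₂, c, L₀)`, `0 < U₁ < U₂`, `0 < c`, the window hypothesis of the crux yields a coupling
`U ∈ (U₁, U₂)` and a threshold `L₁` such that for every even `L ≥ L₁` the matrix elements of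
`Y = Δ_d† Δ_d` on the sector ground eigenspace `E₀(U, L)` of `hubbardTorus 2 L 1 U` (sector
`(2⌊(1-δ)L²/2⌋, S^z = 0)`) are those of a scalar, `⟨w, Y v⟩ = μ ⟨w, v⟩`, then `AverageToEvery`: at
`(U, L)`, `L ≥ max L₀ L₁`, the block average gives (dictionary `stub_blockAverageWitness`) a
normalised sector ground state `ψ₀` with `c L⁴ ≤ re ⟨ψ₀, Y ψ₀⟩ = re μ`, which is then the expectation
of EVERY normalised sector ground state; conclude by `averageToEvery_of_everyGroundState_transfer`.
Tasaki (2020) §2.1, §9.3. [folklore] -/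
theorem averageToEvery_of_scalarOnGround :
    (∀ (δ U₁ U₂ c : ℝ) (L₀ : ℕ), 0 < U₁ → U₁ < U₂ → 0 < c →
      (∀ U ∈ Set.Ioo U₁ U₂, ∀ (L : ℕ) [NeZero L], L₀ ≤ L → Even L →
        c * (L : ℝ) ^ 4 ≤ (((hubbardTorus 2 L 1 U).toBlock
          (fun s : Finset (Orb (FermionTorus 2 L)) => s.card = 2 * ⌊(1 - δ) * (L : ℝ) ^ 2 / 2⌋₊ ∧
            2 * (s.filter fun i => (ofLex i).2 = 0).card = 2 * ⌊(1 - δ) * (L : ℝ) ^ 2 / 2⌋₊)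
          (fun s : Finset (Orb (FermionTorus 2 L)) => s.card = 2 * ⌊(1 - δ) * (L : ℝ) ^ 2 / 2⌋₊ ∧
            2 * (s.filter fun i => (ofLex i).2 = 0).card = 2 * ⌊(1 - δ) * (L : ℝ) ^ 2 / 2⌋₊)).groundStateFunctional
          ((((pairField dWaveFormFactor L)ᴴ * pairField dWaveFormFactor L)).toBlock
          (fun s : Finset (Orb (FermionTorus 2 L)) => s.card = 2 * ⌊(1 - δ) * (L : ℝ) ^ 2 / 2⌋₊ ∧
            2 * (s.filter fun i => (ofLex i).2 = 0).card = 2 * ⌊(1 - δ) * (L : ℝ) ^ 2 / 2⌋₊)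
          (fun s : Finset (Orb (FermionTorus 2 L)) => s.card = 2 * ⌊(1 - δ) * (L : ℝ) ^ 2 / 2⌋₊ ∧
            2 * (s.filter fun i => (ofLex i).2 = 0).card = 2 * ⌊(1 - δ) * (L : ℝ) ^ 2 / 2⌋₊))).re) →
      ∃ U ∈ Set.Ioo U₁ U₂, ∃ L₁ : ℕ, ∀ (L : ℕ) [NeZero L], L₁ ≤ L → Even L →
        ∃ μ : ℂ,
          ∀ v ∈ szSector (2 * ⌊(1 - δ) * (L : ℝ) ^ 2 / 2⌋₊) 0 ⊓
              Module.End.eigenspace (Matrix.toLin' (hubbardTorus 2 L 1 U))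
                ((((hubbardTorus 2 L 1 U).minEnergyOn
                  (szSector (2 * ⌊(1 - δ) * (L : ℝ) ^ 2 / 2⌋₊) 0) : ℝ) : ℂ)),
            ∀ w ∈ szSector (2 * ⌊(1 - δ) * (L : ℝ) ^ 2 / 2⌋₊) 0 ⊓
              Module.End.eigenspace (Matrix.toLin' (hubbardTorus 2 L 1 U))
                ((((hubbardTorus 2 L 1 U).minEnergyOn
                  (szSector (2 * ⌊(1 - δ) * (L : ℝ) ^ 2 / 2⌋₊) 0) : ℝ) : ℂ)),
              star w ⬝ᵥ ((pairField dWaveFormFactor L)ᴴ * pairField dWaveFormFactor L) *ᵥ v = μ * (star w ⬝ᵥ v)) →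
    Summit.HubbardSuperconductivity.HubbardSuperconductivity.Theses.LogColdTorus.AverageToEvery := by
  intro hsc
  refine averageToEvery_of_everyGroundState_transfer fun δ U₁ U₂ c L₀ hU₁ hU₁₂ hc hyp => ?_
  obtain ⟨U, hU, L₁, hL₁⟩ := hsc δ U₁ U₂ c L₀ hU₁ hU₁₂ hc hyp
  refine ⟨U, hU, c, hc, max L₀ L₁, fun L _ hL hLe φ hgs hunit => ?_⟩
  -- (i) the window hypothesis at `(U, L)` and one normalised sector ground state carrying it
  have havg := hyp U hU L ((le_max_left _ _).trans hL) hLe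
  obtain ⟨φ₀, hgs₀, hunit₀, hle₀⟩ :=
    stub_blockAverageWitness U c L ⌊(1 - δ) * (L : ℝ) ^ 2 / 2⌋₊ hc havg
  -- (ii) the scalar
  obtain ⟨μ, hμ⟩ := hL₁ L ((le_max_right _ _).trans hL) hLe
  -- (iii) sector ground states lie in `E₀(U, L)`
  have hmem : ∀ χ : Fock (Orb (FermionTorus 2 L)),
      IsGroundStateInSector (hubbardTorus 2 L 1 U) (2 * ⌊(1 - δ) * (L : ℝ) ^ 2 / 2⌋₊) 0 χ →
      χ ∈ szSector (2 * ⌊(1 - δ) * (L : ℝ) ^ 2 / 2⌋₊) 0 ⊓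
              Module.End.eigenspace (Matrix.toLin' (hubbardTorus 2 L 1 U))
                ((((hubbardTorus 2 L 1 U).minEnergyOn
                  (szSector (2 * ⌊(1 - δ) * (L : ℝ) ^ 2 / 2⌋₊) 0) : ℝ) : ℂ)) := by
    intro χ hχ
    refine Submodule.mem_inf.mpr ⟨hχ.1, ?_⟩
    rw [Module.End.mem_eigenspace_iff, Matrix.toLin'_apply]
    exact hχ.2.2
  -- (iv) every ground state carries the expectation of the good one
  have e1 := hμ φ (hmem φ hgs) φ (hmem φ hgs)
  have e0 := hμ φ₀ (hmem φ₀ hgs₀) φ₀ (hmem φ₀ hgs₀)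
  rw [hunit, mul_one] at e1
  rw [hunit₀, mul_one] at e0
  rw [e1]
  rw [e0] at hle₀
  exact hle₀

/-- **`AverageToEvery` from irreducible ground multiplets at one coupling of the window.** If for all
data the window hypothesis of the crux yields a coupling `U ∈ (U₁, U₂)` and a threshold `L₁` such
that for every even `L ≥ L₁` the sector ground eigenspace `E₀(U, L)` of `hubbardTorus 2 L 1 U` has no
subspace other than `⊥` and itself invariant under every matrix commuting with `H`, `N̂`, `S^z` and
`Δ_d† Δ_d` (irreducibility under the joint commutant — it contains the translations, `D₄`, spin
rotations, time reversal composed with these), then `AverageToEvery`: Schur (`stub_schurScalarOnGround`)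
makes `Δ_d† Δ_d` scalar on `E₀(U, L)`, and `averageToEvery_of_scalarOnGround` applies. The
irreducibility is the residual open claim of the crux. Serre §2.2; Kato (1966) II §6.1. [folklore] -/
theorem averageToEvery_of_irreducibleGround :
    (∀ (δ U₁ U₂ c : ℝ) (L₀ : ℕ), 0 < U₁ → U₁ < U₂ → 0 < c →
      (∀ U ∈ Set.Ioo U₁ U₂, ∀ (L : ℕ) [NeZero L], L₀ ≤ L → Even L →
        c * (L : ℝ) ^ 4 ≤ (((hubbardTorus 2 L 1 U).toBlock
          (fun s : Finset (Orb (FermionTorus 2 L)) => s.card = 2 * ⌊(1 - δ) * (L : ℝ) ^ 2 / 2⌋₊ ∧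
            2 * (s.filter fun i => (ofLex i).2 = 0).card = 2 * ⌊(1 - δ) * (L : ℝ) ^ 2 / 2⌋₊)
          (fun s : Finset (Orb (FermionTorus 2 L)) => s.card = 2 * ⌊(1 - δ) * (L : ℝ) ^ 2 / 2⌋₊ ∧
            2 * (s.filter fun i => (ofLex i).2 = 0).card = 2 * ⌊(1 - δ) * (L : ℝ) ^ 2 / 2⌋₊)).groundStateFunctional
          ((((pairField dWaveFormFactor L)ᴴ * pairField dWaveFormFactor L)).toBlock
          (fun s : Finset (Orb (FermionTorus 2 L)) => s.card = 2 * ⌊(1 - δ) * (L : ℝ) ^ 2 / 2⌋₊ ∧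
            2 * (s.filter fun i => (ofLex i).2 = 0).card = 2 * ⌊(1 - δ) * (L : ℝ) ^ 2 / 2⌋₊)
          (fun s : Finset (Orb (FermionTorus 2 L)) => s.card = 2 * ⌊(1 - δ) * (L : ℝ) ^ 2 / 2⌋₊ ∧
            2 * (s.filter fun i => (ofLex i).2 = 0).card = 2 * ⌊(1 - δ) * (L : ℝ) ^ 2 / 2⌋₊))).re) →
      ∃ U ∈ Set.Ioo U₁ U₂, ∃ L₁ : ℕ, ∀ (L : ℕ) [NeZero L], L₁ ≤ L → Even L →
        ∀ K' : Submodule ℂ (Fock (Orb (FermionTorus 2 L))),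
          K' ≤ szSector (2 * ⌊(1 - δ) * (L : ℝ) ^ 2 / 2⌋₊) 0 ⊓
              Module.End.eigenspace (Matrix.toLin' (hubbardTorus 2 L 1 U))
                ((((hubbardTorus 2 L 1 U).minEnergyOn
                  (szSector (2 * ⌊(1 - δ) * (L : ℝ) ^ 2 / 2⌋₊) 0) : ℝ) : ℂ)) →
          (∀ X : Matrix (Finset (Orb (FermionTorus 2 L))) (Finset (Orb (FermionTorus 2 L))) ℂ,
            X * hubbardTorus 2 L 1 U = hubbardTorus 2 L 1 U * X →
            X * totalNumber = totalNumber * X →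
            X * HubbardWave0.spinZ = HubbardWave0.spinZ * X →
            X * ((pairField dWaveFormFactor L)ᴴ * pairField dWaveFormFactor L) =
              (pairField dWaveFormFactor L)ᴴ * pairField dWaveFormFactor L * X →
            ∀ v ∈ K', X *ᵥ v ∈ K') →
          K' = ⊥ ∨
            K' = szSector (2 * ⌊(1 - δ) * (L : ℝ) ^ 2 / 2⌋₊) 0 ⊓
              Module.End.eigenspace (Matrix.toLin' (hubbardTorus 2 L 1 U))
                ((((hubbardTorus 2 L 1 U).minEnergyOn
                  (szSector (2 * ⌊(1 - δ) * (L : ℝ) ^ 2 / 2⌋₊) 0) : ℝ) : ℂ))) →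
    Summit.HubbardSuperconductivity.HubbardSuperconductivity.Theses.LogColdTorus.AverageToEvery := by
  intro hirr
  refine averageToEvery_of_scalarOnGround fun δ U₁ U₂ c L₀ hU₁ hU₁₂ hc hyp => ?_
  obtain ⟨U, hU, L₁, hL₁⟩ := hirr δ U₁ U₂ c L₀ hU₁ hU₁₂ hc hyp
  exact ⟨U, hU, L₁, fun L _ hL hLe =>
    stub_schurScalarOnGround U L (2 * ⌊(1 - δ) * (L : ℝ) ^ 2 / 2⌋₊) (hL₁ L hL hLe)⟩

/-- **`AverageToEvery` from SIMPLE sector ground states at one coupling of the window.** If for all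
data the window hypothesis of the crux yields a coupling `U ∈ (U₁, U₂)` with, eventually in even `L`,
a NON-DEGENERATE ground state of `hubbardTorus 2 L 1 U` in the sector `(2⌊(1-δ)L²/2⌋, S^z = 0)`
(`dim E₀(U, L) = 1`), then `AverageToEvery` (a line is scalar,
`exists_scalar_matrixElements_of_finrank_eq_one`, then `averageToEvery_of_scalarOnGround`).
Ground-state uniqueness of doped repulsive Hubbard tori at generic coupling is the strongest (and
most studied) form of the genericity bet; it is proved only at half filling (Lieb, PRL 62 (1989)
1201, Thm 2) and for `U < 0` (Thm 1); it is NOT proved here. [folklore] -/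
theorem averageToEvery_of_simpleGround :
    (∀ (δ U₁ U₂ c : ℝ) (L₀ : ℕ), 0 < U₁ → U₁ < U₂ → 0 < c →
      (∀ U ∈ Set.Ioo U₁ U₂, ∀ (L : ℕ) [NeZero L], L₀ ≤ L → Even L →
        c * (L : ℝ) ^ 4 ≤ (((hubbardTorus 2 L 1 U).toBlock
          (fun s : Finset (Orb (FermionTorus 2 L)) => s.card = 2 * ⌊(1 - δ) * (L : ℝ) ^ 2 / 2⌋₊ ∧
            2 * (s.filter fun i => (ofLex i).2 = 0).card = 2 * ⌊(1 - δ) * (L : ℝ) ^ 2 / 2⌋₊)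
          (fun s : Finset (Orb (FermionTorus 2 L)) => s.card = 2 * ⌊(1 - δ) * (L : ℝ) ^ 2 / 2⌋₊ ∧
            2 * (s.filter fun i => (ofLex i).2 = 0).card = 2 * ⌊(1 - δ) * (L : ℝ) ^ 2 / 2⌋₊)).groundStateFunctional
          ((((pairField dWaveFormFactor L)ᴴ * pairField dWaveFormFactor L)).toBlock
          (fun s : Finset (Orb (FermionTorus 2 L)) => s.card = 2 * ⌊(1 - δ) * (L : ℝ) ^ 2 / 2⌋₊ ∧
            2 * (s.filter fun i => (ofLex i).2 = 0).card = 2 * ⌊(1 - δ) * (L : ℝ) ^ 2 / 2⌋₊)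
          (fun s : Finset (Orb (FermionTorus 2 L)) => s.card = 2 * ⌊(1 - δ) * (L : ℝ) ^ 2 / 2⌋₊ ∧
            2 * (s.filter fun i => (ofLex i).2 = 0).card = 2 * ⌊(1 - δ) * (L : ℝ) ^ 2 / 2⌋₊))).re) →
      ∃ U ∈ Set.Ioo U₁ U₂, ∃ L₁ : ℕ, ∀ (L : ℕ) [NeZero L], L₁ ≤ L → Even L →
        Module.finrank ℂ
          ↥(szSector (2 * ⌊(1 - δ) * (L : ℝ) ^ 2 / 2⌋₊) 0 ⊓
              Module.End.eigenspace (Matrix.toLin' (hubbardTorus 2 L 1 U))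
                ((((hubbardTorus 2 L 1 U).minEnergyOn
                  (szSector (2 * ⌊(1 - δ) * (L : ℝ) ^ 2 / 2⌋₊) 0) : ℝ) : ℂ))) = 1) →
    Summit.HubbardSuperconductivity.HubbardSuperconductivity.Theses.LogColdTorus.AverageToEvery := by
  intro hsimple
  refine averageToEvery_of_scalarOnGround fun δ U₁ U₂ c L₀ hU₁ hU₁₂ hc hyp => ?_
  obtain ⟨U, hU, L₁, hL₁⟩ := hsimple δ U₁ U₂ c L₀ hU₁ hU₁₂ hc hyp
  exact ⟨U, hU, L₁, fun L _ hL hLe =>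
    exists_scalar_matrixElements_of_finrank_eq_one _ (hL₁ L hL hLe) _⟩

/-- **`AverageToEvery` from the IRREDUCIBLE-GROUND LAW** (hypothesis-free form of the residual): if for
every real `δ` and every window `(U₁, U₂)`, `0 < U₁ < U₂`, some coupling `U` of the window has, from
some side on and for all even sides, a sector ground eigenspace `E₀(U, L)` irreducible under the joint
commutant of `H`, `N̂`, `S^z`, `Δ_d† Δ_d`, then `AverageToEvery` (the window hypothesis is not even
used). Unlike the window-relative residual this law is refutable by a hidden-symmetry family; it is
the honest conjecture behind "generic couplings have irreducible ground multiplets".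
Koma–Tasaki (1994) Conj. 10 (context). [folklore] -/
theorem averageToEvery_of_irreducibleGroundLaw :
    (∀ (δ U₁ U₂ : ℝ), 0 < U₁ → U₁ < U₂ →
      ∃ U ∈ Set.Ioo U₁ U₂, ∃ L₁ : ℕ, ∀ (L : ℕ) [NeZero L], L₁ ≤ L → Even L →
        ∀ K' : Submodule ℂ (Fock (Orb (FermionTorus 2 L))),
          K' ≤ szSector (2 * ⌊(1 - δ) * (L : ℝ) ^ 2 / 2⌋₊) 0 ⊓
              Module.End.eigenspace (Matrix.toLin' (hubbardTorus 2 L 1 U))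
                ((((hubbardTorus 2 L 1 U).minEnergyOn
                  (szSector (2 * ⌊(1 - δ) * (L : ℝ) ^ 2 / 2⌋₊) 0) : ℝ) : ℂ)) →
          (∀ X : Matrix (Finset (Orb (FermionTorus 2 L))) (Finset (Orb (FermionTorus 2 L))) ℂ,
            X * hubbardTorus 2 L 1 U = hubbardTorus 2 L 1 U * X →
            X * totalNumber = totalNumber * X →
            X * HubbardWave0.spinZ = HubbardWave0.spinZ * X →
            X * ((pairField dWaveFormFactor L)ᴴ * pairField dWaveFormFactor L) =
              (pairField dWaveFormFactor L)ᴴ * pairField dWaveFormFactor L * X →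
            ∀ v ∈ K', X *ᵥ v ∈ K') →
          K' = ⊥ ∨
            K' = szSector (2 * ⌊(1 - δ) * (L : ℝ) ^ 2 / 2⌋₊) 0 ⊓
              Module.End.eigenspace (Matrix.toLin' (hubbardTorus 2 L 1 U))
                ((((hubbardTorus 2 L 1 U).minEnergyOn
                  (szSector (2 * ⌊(1 - δ) * (L : ℝ) ^ 2 / 2⌋₊) 0) : ℝ) : ℂ))) →
    Summit.HubbardSuperconductivity.HubbardSuperconductivity.Theses.LogColdTorus.AverageToEvery := by
  intro hlaw
  exact averageToEvery_of_irreducibleGround fun δ U₁ U₂ _ _ hU₁ hU₁₂ _ _ => hlaw δ U₁ U₂ hU₁ hU₁₂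

/-- **THE CRUX CLOSED MODULO THE BET of line `birth`.** The registered stub
`stub_countableAccidentalCouplings` of `Cruxes/AverageToEvery/Lines/birth.lean` — under the window
hypothesis there are a side `L₁` and COUNTABLE exceptional coupling sets `B L` off which, for every
even `L ≥ L₁`, the sector ground eigenspace `E₀(U, L)` is irreducible under the joint commutant —
taken as a hypothesis, implies `AverageToEvery`: countably many countable sets miss a coupling of the
(non-degenerate, `U₁ < U₂`) window (`exists_mem_Ioo_forall_not_mem`), and
`averageToEvery_of_irreducibleGround` concludes. The hypothesis is the crux's whole open content
(Kato–Rellich genericity of doped Hubbard tori; per side, analytic eigen-branches cross at isolated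
couplings, Kato (1966) II §6.1, but SYSTEMATIC inter-block ground degeneracy along infinitely many
sides is not excluded by anything in print); it is NOT proved here. [folklore] -/
theorem averageToEvery_of_countableAccidentalCouplings :
    (∀ (δ U₁ U₂ c : ℝ) (L₀ : ℕ), 0 < U₁ → U₁ < U₂ → 0 < c →
      (∀ U ∈ Set.Ioo U₁ U₂, ∀ (L : ℕ) [NeZero L], L₀ ≤ L → Even L →
        c * (L : ℝ) ^ 4 ≤ (((hubbardTorus 2 L 1 U).toBlock
          (fun s : Finset (Orb (FermionTorus 2 L)) => s.card = 2 * ⌊(1 - δ) * (L : ℝ) ^ 2 / 2⌋₊ ∧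
            2 * (s.filter fun i => (ofLex i).2 = 0).card = 2 * ⌊(1 - δ) * (L : ℝ) ^ 2 / 2⌋₊)
          (fun s : Finset (Orb (FermionTorus 2 L)) => s.card = 2 * ⌊(1 - δ) * (L : ℝ) ^ 2 / 2⌋₊ ∧
            2 * (s.filter fun i => (ofLex i).2 = 0).card = 2 * ⌊(1 - δ) * (L : ℝ) ^ 2 / 2⌋₊)).groundStateFunctional
          ((((pairField dWaveFormFactor L)ᴴ * pairField dWaveFormFactor L)).toBlock
          (fun s : Finset (Orb (FermionTorus 2 L)) => s.card = 2 * ⌊(1 - δ) * (L : ℝ) ^ 2 / 2⌋₊ ∧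
            2 * (s.filter fun i => (ofLex i).2 = 0).card = 2 * ⌊(1 - δ) * (L : ℝ) ^ 2 / 2⌋₊)
          (fun s : Finset (Orb (FermionTorus 2 L)) => s.card = 2 * ⌊(1 - δ) * (L : ℝ) ^ 2 / 2⌋₊ ∧
            2 * (s.filter fun i => (ofLex i).2 = 0).card = 2 * ⌊(1 - δ) * (L : ℝ) ^ 2 / 2⌋₊))).re) →
      ∃ L₁ : ℕ, ∃ B : ℕ → Set ℝ, (∀ L, (B L).Countable) ∧
        ∀ (L : ℕ) [NeZero L], L₁ ≤ L → Even L → ∀ U ∈ Set.Ioo U₁ U₂, U ∉ B L →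
          ∀ K' : Submodule ℂ (Fock (Orb (FermionTorus 2 L))),
            K' ≤ szSector (2 * ⌊(1 - δ) * (L : ℝ) ^ 2 / 2⌋₊) 0 ⊓
              Module.End.eigenspace (Matrix.toLin' (hubbardTorus 2 L 1 U))
                ((((hubbardTorus 2 L 1 U).minEnergyOn
                  (szSector (2 * ⌊(1 - δ) * (L : ℝ) ^ 2 / 2⌋₊) 0) : ℝ) : ℂ)) →
            (∀ X : Matrix (Finset (Orb (FermionTorus 2 L))) (Finset (Orb (FermionTorus 2 L))) ℂ,
              X * hubbardTorus 2 L 1 U = hubbardTorus 2 L 1 U * X →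
              X * totalNumber = totalNumber * X →
              X * HubbardWave0.spinZ = HubbardWave0.spinZ * X →
              X * ((pairField dWaveFormFactor L)ᴴ * pairField dWaveFormFactor L) =
                (pairField dWaveFormFactor L)ᴴ * pairField dWaveFormFactor L * X →
              ∀ v ∈ K', X *ᵥ v ∈ K') →
            K' = ⊥ ∨
              K' = szSector (2 * ⌊(1 - δ) * (L : ℝ) ^ 2 / 2⌋₊) 0 ⊓
                Module.End.eigenspace (Matrix.toLin' (hubbardTorus 2 L 1 U))
                  ((((hubbardTorus 2 L 1 U).minEnergyOn
                    (szSector (2 * ⌊(1 - δ) * (L : ℝ) ^ 2 / 2⌋₊) 0) : ℝ) : ℂ))) →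
    Summit.HubbardSuperconductivity.HubbardSuperconductivity.Theses.LogColdTorus.AverageToEvery := by
  intro hbet
  refine averageToEvery_of_irreducibleGround fun δ U₁ U₂ c L₀ hU₁ hU₁₂ hc hyp => ?_
  obtain ⟨L₁, B, hBc, hgood⟩ := hbet δ U₁ U₂ c L₀ hU₁ hU₁₂ hc hyp
  obtain ⟨U, hU, hUB⟩ := exists_mem_Ioo_forall_not_mem hU₁₂ B hBc
  exact ⟨U, hU, L₁, fun L _ hL hLe => hgood L hL hLe U hU (hUB L)⟩

end Summit.HubbardSuperconductivity.HubbardSuperconductivity.Theorems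

end
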